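import Summits.Ventures.QEC.Census.BB.BB144.BZAutData
import Summits.Ventures.QEC.Census.CertCheckBZMitm
import HarnessLib

/-!
# `BB144` — meet-in-the-middle replay of the `bz_aut` enumeration matrices, side Z, block 2 (matrix 1, parts 9–11)

Matrix 1 (depth 5) of block 2: parts 9–11 (layer 5, groups 0–2).

KERNEL tier (`decide +kernel`, axioms standard): each theorem states that one PART of the meet-in-the-middle replay
(`Census/CertCheckBZMitm.lean`, `DistCert.bzZMitm`) of one enumeration matrix of block 2 of the `bz_aut` certificate
`7c1e929a56946658` of `[[144,12,12]]` (`BB144.bzAutData`, emitted by qec-search-7) passes: part 0 = layers 1–2 + group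
side conditions, part 1 = layer 3 (direct), parts 2–8 = layer 4 on the 7 redundancy-column groups, parts 9–14 = layer 5
on the 6 groups (vacuous for a depth-4 matrix).  With the soundness theorem of `Census/CertCheckBZMitmSound.lean`
these replace the `native_decide` enumeration verdicts (`BZAutEnumZ*.lean`) of the same matrices by KERNEL-checked
ones; no distance value is asserted here.  Generated by HOME/census/search-9/bzmitm/gen_parts.py (qec-search-9).
-/

namespace Summit.Ventures.QEC.Census.BB144

open Summit.Ventures.QEC.Census

set_option maxHeartbeats 4000000 in
/-- `bz_aut` certificate `7c1e929a`, side Z, block 2, matrix 1: part 9 of the meet-in-the-middle replay passes. -/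
theorem bzAutMitmZ_2_1_9 : cert.bzZMitm bzAutData 2 1 9 = true := by
  decide +kernel

set_option maxHeartbeats 4000000 in
/-- `bz_aut` certificate `7c1e929a`, side Z, block 2, matrix 1: part 10 of the meet-in-the-middle replay passes. -/
theorem bzAutMitmZ_2_1_10 : cert.bzZMitm bzAutData 2 1 10 = true := by
  decide +kernel

set_option maxHeartbeats 4000000 in
/-- `bz_aut` certificate `7c1e929a`, side Z, block 2, matrix 1: part 11 of the meet-in-the-middle replay passes. -/
theorem bzAutMitmZ_2_1_11 : cert.bzZMitm bzAutData 2 1 11 = true := by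
  decide +kernel

end Summit.Ventures.QEC.Census.BB144
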